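import Summits.AnomalousDissipation.AnomalousDissipation.Theorems.MirrorStatisticsLoudTG.Negative.LoadBearing
import Summits.AnomalousDissipation.AnomalousDissipation.Theorems.MirrorEnsembleMirrorStatisticsLoudTGStubTubeProfilesKTools
import Literature.Analysis.FunctionSpaces.PeriodicLogCost
import Literature.Analysis.FunctionSpaces.FlatTorusProofs
import HarnessLib

/-!
# Stub `stub_tubeProfilesK` of line `regimes`, crux `MirrorEnsemble.MirrorStatisticsLoudTG` (stmt-AnomalousDissipation-17693)

T1 of the statistical Kelvin programme: THE TUBE CURRENT OF THE SKELETON LOOP. For every scale `0 < δ ≤ δ₁ = 1/16`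
there are smooth `1`-periodic profiles `ρ` (a plateau of the cell side `[0, ½]`, `|ρ| ≤ 1`, `|ρ'| ≤ A/δ`, `ρ' ≠ 0` on
`[0, 1]` only in the windows `(δ, 2δ) ∪ (½ − 2δ, ½ − δ)`) and `η` (a bump in the normal variable, `|η| ≤ A/δ`,
`η = 0` on `[δ, 1 − δ]`), with an absolute constant `A ≥ 1`, such that the tube current

  `g(x) = (η(x₂) ρ(x₀) ρ'(x₁), −η(x₂) ρ'(x₀) ρ(x₁), 0)`  (coordinates `xᵢ = Torus.repr x i ∈ [0, 1)`)

— the smoothed unit current of the skeleton loop `C = ∂([0,½]² × {x₂ = 0})` of the Taylor–Green cell — is smooth,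
divergence free and mean zero on `T³`, and is paired with the Taylor–Green force by `(f_TG, g) ≥ 1`.

* Torus side (this file, for ANY smooth `1`-periodic `ρ`, `η`): the lift of `g` along `proj` is the same formula
  in the flat coordinates (`1`-periodicity makes `ρ ∘ reprᵢ ∘ proj = ρ ∘ evalᵢ`, `TubeProfilesK.periodic_repr_proj`),
  whence smoothness (`isSmooth_field`) and `div g = η ρ'ρ' − η ρ'ρ' = 0` (`isDivFree_field`); Fubini on
  `T³ = (ℝ/ℤ)³` through the measure-preserving section `repr` (`integral_repr_prod`) gives `∫ g = 0` from
  `∫₀¹ ρ' = 0` (`hasZeroMean_field`) and the PAIRING FORMULA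
  `(f_TG, g) = 2 J_s J_c I_η`, `J_s = ∫₀¹ sin(2πt)ρ`, `J_c = ∫₀¹ cos(2πt)ρ' = 2π J_s` (parts), `I_η = ∫₀¹ cos(2πt)η`
  (`integral_inner_tgForce_field`, `integral_cos_mul_deriv`).
* Profiles (`…StubTubeProfilesKTools`, registered sub-stub `stub_tubeProfilesKTools`): `ρ = S ∘ u`,
  `η = (8/δ) S ∘ v` with Mathlib's `Real.smoothTransition` and trigonometric arguments; `J_s ≥ √2/8`, `I_η ≥ 31/8`,
  so `(f_TG, g) = 4π J_s² I_η ≥ 31π/64 > 1`.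

Sources: M. E. Brachet et al., J. Fluid Mech. 130 (1983) 411–452, §2 (the impermeable box of the TG symmetries);
L. Grafakos, *Classical Fourier Analysis* (3rd ed.), §3.1.1 (calculus and integration on `Tⁿ` via `[0,1)ⁿ`). [folklore]
-/

-- every `Summit.AnomalousDissipation.AnomalousDissipation.…` name repeats the summit = problem segment (tree layout)
set_option linter.dupNamespace false

noncomputable section

namespace Summit.AnomalousDissipation.AnomalousDissipation.Theorems.MirrorEnsembleMirrorStatisticsLoudTG

open MeasureTheory Filter Topology
open scoped ENNReal InnerProductSpace NNReal ContDiff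
open Literature.Analysis.FunctionSpaces Literature.Analysis.FluidPDE
open Summit.AnomalousDissipation.AnomalousDissipation.Theorems.TaylorGreenLoudGalerkinStates.Negative
  (tgForce isSmooth_tgForce isDivFree_tgForce hasZeroMean_tgForce integral_norm_sq_tgForce)
namespace TubeProfilesK

/-! ## Integration on `T³` through the fundamental domain -/

/-- Integration on the circle through the fundamental-domain coordinate `equivIco : ℝ/ℤ → [0, 1)`
(a measure-preserving measurable embedding, `Torus.measurePreserving_equivIco_coe`). [folklore] -/
theorem integral_comp_equivIco (φ : ℝ → ℝ) :
    ∫ c : UnitAddCircle, φ (AddCircle.equivIco (1 : ℝ) 0 c) = ∫ t in (0 : ℝ)..1, φ t := by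
  have hmp := Torus.measurePreserving_equivIco_coe
  have hemb : MeasurableEmbedding (fun y : UnitAddCircle => ((AddCircle.equivIco (1 : ℝ) (0 : ℝ) y : ℝ))) :=
    (MeasurableEmbedding.subtype_coe measurableSet_Ico).comp
      (AddCircle.measurableEquivIco (1 : ℝ) (0 : ℝ)).measurableEmbedding
  rw [hmp.integral_comp hemb, integral_Ico_eq_integral_Ioc, intervalIntegral.integral_of_le zero_le_one]

/-- **Fubini on `T³`** for a product of functions of one fundamental-domain coordinate each:
`∫ φ₀(x₀) φ₁(x₁) φ₂(x₂) dx = (∫₀¹ φ₀)(∫₀¹ φ₁)(∫₀¹ φ₂)` (`volume` on `T³` is the product measure). [folklore] -/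
theorem integral_repr_prod (φ₀ φ₁ φ₂ : ℝ → ℝ) :
    ∫ x : UnitAddTorus (Fin 3), φ₀ (Torus.repr x 0) * φ₁ (Torus.repr x 1) * φ₂ (Torus.repr x 2) =
      (∫ t in (0 : ℝ)..1, φ₀ t) * (∫ t in (0 : ℝ)..1, φ₁ t) * ∫ t in (0 : ℝ)..1, φ₂ t := by
  have h := integral_fin_nat_prod_volume_eq_prod (E := fun _ : Fin 3 => UnitAddCircle)
    (![fun c => φ₀ (AddCircle.equivIco (1 : ℝ) 0 c), fun c => φ₁ (AddCircle.equivIco (1 : ℝ) 0 c),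
      fun c => φ₂ (AddCircle.equivIco (1 : ℝ) 0 c)])
  simp only [Fin.prod_univ_three, Matrix.cons_val_zero, Matrix.cons_val_one, Matrix.cons_val_two,
    Matrix.head_cons, Matrix.tail_cons, integral_comp_equivIco] at h
  simpa [Torus.repr_apply] using h

/-- The coordinates of a point of `T³` are the classes of its fundamental-domain coordinates. [folklore] -/
theorem apply_eq_coe_repr (x : UnitAddTorus (Fin 3)) (i : Fin 3) :
    x i = ((Torus.repr x i : ℝ) : UnitAddCircle) := by
  conv_lhs => rw [← Torus.proj_repr x]
  rfl

/-- A `1`-periodic function does not distinguish `repr (proj y)` from `y` (they differ by a lattice vector). [folklore] -/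
theorem periodic_repr_proj {φ : ℝ → ℝ} (hφ : Function.Periodic φ 1) (y : EuclideanSpace ℝ (Fin 3)) (i : Fin 3) :
    φ (Torus.repr (Torus.proj y) i) = φ (y i) := by
  obtain ⟨k, hk⟩ := Torus.exists_repr_proj_eq_add_latticeVec_holds y
  rw [hk, PiLp.add_apply, Torus.latticeVec_apply]
  simpa using (hφ.int_mul (k i)) (y i)

/-- The derivative of a `1`-periodic function is `1`-periodic. [folklore] -/
theorem periodic_deriv {φ : ℝ → ℝ} (hφ : Function.Periodic φ 1) : Function.Periodic (deriv φ) 1 := by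
  intro t
  have h : (fun s => φ (s + 1)) = φ := funext hφ
  rw [← deriv_comp_add_const, h]

/-- `Im e₁(xᵢ) = sin(2π xᵢ)` in the fundamental-domain coordinate. [folklore] -/
theorem fourier_im (x : UnitAddTorus (Fin 3)) (i : Fin 3) :
    ((fourier 1 (x i) : ℂ)).im = Real.sin (2 * Real.pi * Torus.repr x i) := by
  rw [apply_eq_coe_repr x i, Torus.fourier_one_coe, Complex.exp_ofReal_mul_I_im]

/-- `Re e₁(xᵢ) = cos(2π xᵢ)` in the fundamental-domain coordinate. [folklore] -/
theorem fourier_re (x : UnitAddTorus (Fin 3)) (i : Fin 3) :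
    ((fourier 1 (x i) : ℂ)).re = Real.cos (2 * Real.pi * Torus.repr x i) := by
  rw [apply_eq_coe_repr x i, Torus.fourier_one_coe, Complex.exp_ofReal_mul_I_re]

/-! ## The tube current of arbitrary smooth periodic profiles -/

section Field

variable {ρ η : ℝ → ℝ}

/-- **Smoothness.** The lift of the tube current along `proj` is `y ↦ (η(y₂)ρ(y₀)ρ'(y₁), −η(y₂)ρ'(y₀)ρ(y₁), 0)`,
a smooth map `ℝ³ → ℝ³`. [folklore] -/
theorem isSmooth_field (hρs : ContDiff ℝ ∞ ρ) (hηs : ContDiff ℝ ∞ η) (hρ : Function.Periodic ρ 1)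
    (hη : Function.Periodic η 1) :
    Torus.IsSmooth (fun x : UnitAddTorus (Fin 3) =>
      (!₂[η (Torus.repr x 2) * ρ (Torus.repr x 0) * deriv ρ (Torus.repr x 1),
        -(η (Torus.repr x 2) * deriv ρ (Torus.repr x 0) * ρ (Torus.repr x 1)), (0 : ℝ)] : EuclideanSpace ℝ (Fin 3))) := by
  have hd : ContDiff ℝ ∞ (deriv ρ) := (contDiff_infty_iff_deriv.1 hρs).2
  have hc : ∀ j : Fin 3, ContDiff ℝ ∞ (fun y : EuclideanSpace ℝ (Fin 3) => (y j : ℝ)) := fun j =>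
    (EuclideanSpace.proj (𝕜 := ℝ) j).contDiff
  unfold Torus.IsSmooth Torus.lift
  have e : ((fun x : UnitAddTorus (Fin 3) =>
      (!₂[η (Torus.repr x 2) * ρ (Torus.repr x 0) * deriv ρ (Torus.repr x 1),
        -(η (Torus.repr x 2) * deriv ρ (Torus.repr x 0) * ρ (Torus.repr x 1)), (0 : ℝ)] : EuclideanSpace ℝ (Fin 3))) ∘
        Torus.proj) = fun y =>
      !₂[η (y 2) * ρ (y 0) * deriv ρ (y 1), -(η (y 2) * deriv ρ (y 0) * ρ (y 1)), (0 : ℝ)] := by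
    funext y
    simp only [Function.comp_apply, periodic_repr_proj hρ, periodic_repr_proj hη,
      periodic_repr_proj (periodic_deriv hρ)]
  rw [e, contDiff_euclidean]
  intro i
  fin_cases i
  · exact ((hηs.comp (hc 2)).mul (hρs.comp (hc 0))).mul (hd.comp (hc 1))
  · exact (((hηs.comp (hc 2)).mul (hd.comp (hc 0))).mul (hρs.comp (hc 1))).neg
  · exact contDiff_const

/-- **Solenoidality.** `div g = ∂₀(η ρ ρ'(x₁)) + ∂₁(−η ρ'(x₀) ρ) = η ρ'(x₀)ρ'(x₁) − η ρ'(x₀)ρ'(x₁) = 0`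
(partial derivatives along the lines `x + proj(t eᵢ) = proj(y + t eᵢ)`). [folklore] -/
theorem isDivFree_field (hρs : ContDiff ℝ ∞ ρ) (hρ : Function.Periodic ρ 1) (hη : Function.Periodic η 1) :
    Torus.IsDivFree (fun x : UnitAddTorus (Fin 3) =>
      (!₂[η (Torus.repr x 2) * ρ (Torus.repr x 0) * deriv ρ (Torus.repr x 1),
        -(η (Torus.repr x 2) * deriv ρ (Torus.repr x 0) * ρ (Torus.repr x 1)), (0 : ℝ)] : EuclideanSpace ℝ (Fin 3))) := by
  have hdiff : Differentiable ℝ ρ := (contDiff_infty_iff_deriv.1 hρs).1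
  intro x
  obtain ⟨y, rfl⟩ := Torus.proj_surjective x
  simp only [Torus.divergence, Torus.partialDeriv, Torus.lineDeriv, ← Torus.proj_add,
    Fin.sum_univ_three, Matrix.cons_val_zero, Matrix.cons_val_one, Matrix.cons_val_two,
    Matrix.head_cons, Matrix.tail_cons, periodic_repr_proj hρ, periodic_repr_proj hη,
    periodic_repr_proj (periodic_deriv hρ), PiLp.add_apply, PiLp.smul_apply, PiLp.single_apply]
  simp only [Fin.isValue, Fin.reduceEq, ↓reduceIte, smul_eq_mul, mul_one, mul_zero, add_zero, deriv_const]
  have h0 : HasDerivAt (fun t : ℝ => η (y 2) * ρ (y 0 + t) * deriv ρ (y 1))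
      (η (y 2) * deriv ρ (y 0) * deriv ρ (y 1)) 0 := by
    have h := (hdiff (y 0 + 0)).hasDerivAt.comp_const_add (y 0) 0
    rw [add_zero] at h
    exact (h.const_mul (η (y 2))).mul_const (deriv ρ (y 1))
  have h1 : HasDerivAt (fun t : ℝ => -(η (y 2) * deriv ρ (y 0) * ρ (y 1 + t)))
      (-(η (y 2) * deriv ρ (y 0) * deriv ρ (y 1))) 0 := by
    have h := (hdiff (y 1 + 0)).hasDerivAt.comp_const_add (y 1) 0
    rw [add_zero] at h
    exact (h.const_mul (η (y 2) * deriv ρ (y 0))).neg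
  rw [h0.deriv, h1.deriv]
  ring

/-- **Zero mean.** Coordinatewise `∫ g₀ = (∫₀¹ρ)(∫₀¹ρ')(∫₀¹η)`, `∫ g₁ = −(∫₀¹ρ')(∫₀¹ρ)(∫₀¹η)`, and
`∫₀¹ ρ' = ρ(1) − ρ(0) = 0` by periodicity. [folklore] -/
theorem hasZeroMean_field (hρs : ContDiff ℝ ∞ ρ) (hηs : ContDiff ℝ ∞ η) (hρ : Function.Periodic ρ 1)
    (hη : Function.Periodic η 1) :
    Torus.HasZeroMean (fun x : UnitAddTorus (Fin 3) =>
      (!₂[η (Torus.repr x 2) * ρ (Torus.repr x 0) * deriv ρ (Torus.repr x 1),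
        -(η (Torus.repr x 2) * deriv ρ (Torus.repr x 0) * ρ (Torus.repr x 1)), (0 : ℝ)] : EuclideanSpace ℝ (Fin 3))) := by
  have hsm := isSmooth_field hρs hηs hρ hη
  set g : UnitAddTorus (Fin 3) → EuclideanSpace ℝ (Fin 3) := fun x =>
      !₂[η (Torus.repr x 2) * ρ (Torus.repr x 0) * deriv ρ (Torus.repr x 1),
        -(η (Torus.repr x 2) * deriv ρ (Torus.repr x 0) * ρ (Torus.repr x 1)), (0 : ℝ)] with hg
  have hdiff : Differentiable ℝ ρ := (contDiff_infty_iff_deriv.1 hρs).1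
  have hdc : Continuous (deriv ρ) := hρs.continuous_deriv (by simp)
  have hzero : ∫ t in (0 : ℝ)..1, deriv ρ t = 0 := by
    rw [intervalIntegral.integral_deriv_eq_sub (fun t _ => hdiff t) (hdc.intervalIntegrable 0 1)]
    have := hρ 0
    rw [zero_add] at this
    rw [this, sub_self]
  have h0 : ∫ x, g x 0 = 0 := by
    have e : ∀ x, g x 0 = ρ (Torus.repr x 0) * deriv ρ (Torus.repr x 1) * η (Torus.repr x 2) := fun x => by
      simp only [hg, PiLp.toLp_apply, Matrix.cons_val_zero]; ring
    simp_rw [e, integral_repr_prod, hzero]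
    ring
  have h1 : ∫ x, g x 1 = 0 := by
    have e : ∀ x, g x 1 = -(deriv ρ (Torus.repr x 0) * ρ (Torus.repr x 1) * η (Torus.repr x 2)) := fun x => by
      simp only [hg, PiLp.toLp_apply, Matrix.cons_val_one, Matrix.cons_val_zero]; ring
    simp_rw [e]
    rw [integral_neg, integral_repr_prod, hzero]
    ring
  have h2 : ∫ x, g x 2 = 0 := by
    have e : ∀ x, g x 2 = 0 := fun x => by
      simp only [hg, PiLp.toLp_apply, Matrix.cons_val_two, Matrix.tail_cons, Matrix.head_cons]
    simp_rw [e, integral_zero]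
  rw [Torus.HasZeroMean]
  ext i
  rw [show (∫ x, g x) i = EuclideanSpace.proj (𝕜 := ℝ) i (∫ x, g x) from rfl,
    ← (EuclideanSpace.proj (𝕜 := ℝ) i).integral_comp_comm hsm.integrable]
  fin_cases i
  · simpa using h0
  · simpa using h1
  · simpa using h2

/-- **The pairing formula.** With `f_TG = (sin2πx₀ cos2πx₁ cos2πx₂, −cos2πx₀ sin2πx₁ cos2πx₂, 0)`:
`∫ ⟪f_TG, g⟫ = 2 (∫₀¹ sin(2πt)ρ) (∫₀¹ cos(2πt)ρ') (∫₀¹ cos(2πt)η)` (both nonzero components contribute the same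
product of one-dimensional integrals). [folklore] -/
theorem integral_inner_tgForce_field (hρs : ContDiff ℝ ∞ ρ) (hηs : ContDiff ℝ ∞ η) (hρ : Function.Periodic ρ 1)
    (hη : Function.Periodic η 1) :
    ∫ x, ⟪tgForce x, (!₂[η (Torus.repr x 2) * ρ (Torus.repr x 0) * deriv ρ (Torus.repr x 1),
        -(η (Torus.repr x 2) * deriv ρ (Torus.repr x 0) * ρ (Torus.repr x 1)), (0 : ℝ)] : EuclideanSpace ℝ (Fin 3))⟫_ℝ =
      2 * ((∫ t in (0 : ℝ)..1, Real.sin (2 * Real.pi * t) * ρ t) *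
        (∫ t in (0 : ℝ)..1, Real.cos (2 * Real.pi * t) * deriv ρ t) *
        ∫ t in (0 : ℝ)..1, Real.cos (2 * Real.pi * t) * η t) := by
  have hsm := isSmooth_field hρs hηs hρ hη
  set g : UnitAddTorus (Fin 3) → EuclideanSpace ℝ (Fin 3) := fun x =>
      !₂[η (Torus.repr x 2) * ρ (Torus.repr x 0) * deriv ρ (Torus.repr x 1),
        -(η (Torus.repr x 2) * deriv ρ (Torus.repr x 0) * ρ (Torus.repr x 1)), (0 : ℝ)] with hg
  show ∫ x, ⟪tgForce x, g x⟫_ℝ = _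
  have hgc : ∀ i, Continuous fun x => g x i := fun i => (hsm.apply i).continuous
  have hfc : ∀ i, Continuous fun x => tgForce x i := fun i => (isSmooth_tgForce.apply i).continuous
  have e : ∀ x, ⟪tgForce x, g x⟫_ℝ = tgForce x 0 * g x 0 + tgForce x 1 * g x 1 := by
    intro x
    simp only [PiLp.inner_apply, RCLike.inner_apply, conj_trivial, Fin.sum_univ_three, hg, tgForce,
      PiLp.toLp_apply, Matrix.cons_val_two, Matrix.tail_cons, Matrix.head_cons]
    ring
  have e0 : ∀ x, tgForce x 0 * g x 0 =
      (Real.sin (2 * Real.pi * Torus.repr x 0) * ρ (Torus.repr x 0)) *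
        (Real.cos (2 * Real.pi * Torus.repr x 1) * deriv ρ (Torus.repr x 1)) *
        (Real.cos (2 * Real.pi * Torus.repr x 2) * η (Torus.repr x 2)) := by
    intro x
    simp only [hg, tgForce, PiLp.toLp_apply, Matrix.cons_val_zero, fourier_im, fourier_re]
    ring
  have e1 : ∀ x, tgForce x 1 * g x 1 =
      (Real.cos (2 * Real.pi * Torus.repr x 0) * deriv ρ (Torus.repr x 0)) *
        (Real.sin (2 * Real.pi * Torus.repr x 1) * ρ (Torus.repr x 1)) *
        (Real.cos (2 * Real.pi * Torus.repr x 2) * η (Torus.repr x 2)) := by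
    intro x
    simp only [hg, tgForce, PiLp.toLp_apply, Matrix.cons_val_one, Matrix.cons_val_zero, fourier_im, fourier_re]
    ring
  simp_rw [e]
  have i0 : Integrable (fun x => tgForce x 0 * g x 0) volume := ((hfc 0).mul (hgc 0)).integrable_unitAddTorus
  have i1 : Integrable (fun x => tgForce x 1 * g x 1) volume := ((hfc 1).mul (hgc 1)).integrable_unitAddTorus
  rw [integral_add i0 i1]
  simp_rw [e0, e1]
  have k0 := integral_repr_prod (fun r => Real.sin (2 * Real.pi * r) * ρ r)
    (fun r => Real.cos (2 * Real.pi * r) * deriv ρ r) (fun r => Real.cos (2 * Real.pi * r) * η r)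
  have k1 := integral_repr_prod (fun r => Real.cos (2 * Real.pi * r) * deriv ρ r)
    (fun r => Real.sin (2 * Real.pi * r) * ρ r) (fun r => Real.cos (2 * Real.pi * r) * η r)
  beta_reduce at k0 k1
  rw [k0, k1]
  ring

/-- **Integration by parts over a period**: `∫₀¹ cos(2πt) ρ'(t) dt = 2π ∫₀¹ sin(2πt) ρ(t) dt` for smooth
`1`-periodic `ρ` (the boundary term `ρ(1) − ρ(0)` vanishes). [folklore] -/
theorem integral_cos_mul_deriv (hρs : ContDiff ℝ ∞ ρ) (hρ : Function.Periodic ρ 1) :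
    ∫ t in (0 : ℝ)..1, Real.cos (2 * Real.pi * t) * deriv ρ t =
      2 * Real.pi * ∫ t in (0 : ℝ)..1, Real.sin (2 * Real.pi * t) * ρ t := by
  have hdiff : Differentiable ℝ ρ := (contDiff_infty_iff_deriv.1 hρs).1
  have hdc : Continuous (deriv ρ) := hρs.continuous_deriv (by simp)
  have hcos : ∀ t, HasDerivAt (fun s : ℝ => Real.cos (2 * Real.pi * s)) (-(2 * Real.pi) * Real.sin (2 * Real.pi * t)) t := by
    intro t
    have h := ((hasDerivAt_id t).const_mul (2 * Real.pi)).cos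
    simp only [id, mul_one] at h
    exact h.congr_deriv (by ring)
  have h := intervalIntegral.integral_mul_deriv_eq_deriv_mul (a := 0) (b := 1)
    (u := fun s : ℝ => Real.cos (2 * Real.pi * s)) (u' := fun t => -(2 * Real.pi) * Real.sin (2 * Real.pi * t))
    (v := ρ) (v' := deriv ρ) (fun t _ => hcos t) (fun t _ => (hdiff t).hasDerivAt)
    ((by fun_prop : Continuous fun t : ℝ => -(2 * Real.pi) * Real.sin (2 * Real.pi * t)).intervalIntegrable 0 1)
    (hdc.intervalIntegrable 0 1)
  rw [h]
  have h1 : ρ 1 = ρ 0 := by simpa using hρ 0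
  have h2 : ∫ t in (0 : ℝ)..1, -(2 * Real.pi) * Real.sin (2 * Real.pi * t) * ρ t =
      -(2 * Real.pi) * ∫ t in (0 : ℝ)..1, Real.sin (2 * Real.pi * t) * ρ t := by
    rw [← intervalIntegral.integral_const_mul]
    exact intervalIntegral.integral_congr fun t _ => by ring
  rw [h2, mul_one, mul_zero, Real.cos_zero, Real.cos_two_pi, one_mul, h1]
  ring

end Field

end TubeProfilesK

open TubeProfilesK in
/-- **T1 `stub_tubeProfilesK` — the tube current of the skeleton loop.** There are an absolute `A ≥ 1` and
`δ₁ = 1/16` such that for every `0 < δ ≤ δ₁` smooth `1`-periodic profiles `ρ`, `η` exist with `|η| ≤ A/δ`,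
`|ρ| ≤ 1`, `|ρ'| ≤ A/δ`, `η = 0` on `[δ, 1 − δ]`, `ρ' ≠ 0` on `[0, 1]` only in `(δ, 2δ) ∪ (½ − 2δ, ½ − δ)`, for
which the tube current `g = (η(x₂)ρ(x₀)ρ'(x₁), −η(x₂)ρ'(x₀)ρ(x₁), 0)` is smooth, divergence free, mean zero, and
`(f_TG, g) ≥ 1`. Proof: profiles from `stub_tubeProfilesKTools` (`A = max(M, 8)`), torus bookkeeping from the
`TubeProfilesK` lemmas above, and `(f_TG, g) = 4π J_s² I_η ≥ 4π · (1/32) · (31/8) > 1`. [folklore] -/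
theorem stub_tubeProfilesK :
    ∃ A δ₁ : ℝ, 1 ≤ A ∧ 0 < δ₁ ∧ δ₁ ≤ 16⁻¹ ∧ ∀ δ : ℝ, 0 < δ → δ ≤ δ₁ →
      ∃ ρ η : ℝ → ℝ, ContDiff ℝ (⊤ : ℕ∞) ρ ∧ ContDiff ℝ (⊤ : ℕ∞) η ∧ Function.Periodic ρ 1 ∧ Function.Periodic η 1 ∧
        (∀ t, |η t| ≤ A / δ) ∧ (∀ t, |ρ t| ≤ 1) ∧ (∀ t, |deriv ρ t| ≤ A / δ) ∧
        (∀ t, δ ≤ t → t ≤ 1 - δ → η t = 0) ∧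
        (∀ t, 0 ≤ t → t ≤ 1 → deriv ρ t ≠ 0 → (δ < t ∧ t < 2 * δ) ∨ (2⁻¹ - 2 * δ < t ∧ t < 2⁻¹ - δ)) ∧
        Torus.IsSmooth (fun x : UnitAddTorus (Fin 3) =>
          !₂[η (Torus.repr x 2) * ρ (Torus.repr x 0) * deriv ρ (Torus.repr x 1),
             -(η (Torus.repr x 2) * deriv ρ (Torus.repr x 0) * ρ (Torus.repr x 1)), (0 : ℝ)]) ∧
        Torus.IsDivFree (fun x : UnitAddTorus (Fin 3) =>
          !₂[η (Torus.repr x 2) * ρ (Torus.repr x 0) * deriv ρ (Torus.repr x 1),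
             -(η (Torus.repr x 2) * deriv ρ (Torus.repr x 0) * ρ (Torus.repr x 1)), (0 : ℝ)]) ∧
        Torus.HasZeroMean (fun x : UnitAddTorus (Fin 3) =>
          !₂[η (Torus.repr x 2) * ρ (Torus.repr x 0) * deriv ρ (Torus.repr x 1),
             -(η (Torus.repr x 2) * deriv ρ (Torus.repr x 0) * ρ (Torus.repr x 1)), (0 : ℝ)]) ∧
        1 ≤ ∫ x, ⟪tgForce x, !₂[η (Torus.repr x 2) * ρ (Torus.repr x 0) * deriv ρ (Torus.repr x 1),
             -(η (Torus.repr x 2) * deriv ρ (Torus.repr x 0) * ρ (Torus.repr x 1)), (0 : ℝ)]⟫_ℝ := by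
  obtain ⟨⟨M, hM0, hM⟩, hEta, hJs⟩ := stub_tubeProfilesKTools
  refine ⟨max M 8, 16⁻¹, le_max_of_le_right (by norm_num), by norm_num, le_rfl, fun δ hδ hδ' => ?_⟩
  obtain ⟨ρ, hρs, hρp, hρ0, hρ1, hρd, hρw, hρsin, hρone⟩ := hM δ hδ hδ'
  obtain ⟨η, hηs, hηp, hη0, hη8, hηz, hηI⟩ := hEta δ hδ hδ'
  refine ⟨ρ, η, hρs, hηs, hρp, hηp, ?_, ?_, ?_, hηz, hρw, isSmooth_field hρs hηs hρp hηp,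
    isDivFree_field hρs hρp hηp, hasZeroMean_field hρs hηs hρp hηp, ?_⟩
  · intro t
    rw [abs_of_nonneg (hη0 t)]
    exact (hη8 t).trans (div_le_div_of_nonneg_right (le_max_right _ _) hδ.le)
  · intro t
    rw [abs_of_nonneg (hρ0 t)]
    exact hρ1 t
  · intro t
    exact (hρd t).trans (div_le_div_of_nonneg_right (le_max_left _ _) hδ.le)
  · rw [integral_inner_tgForce_field hρs hηs hρp hηp, integral_cos_mul_deriv hρs hρp]
    have hJ := hJs ρ hρs.continuous hρsin hρone
    set J := ∫ t in (0 : ℝ)..1, Real.sin (2 * Real.pi * t) * ρ t with hJdef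
    set I := ∫ t in (0 : ℝ)..1, Real.cos (2 * Real.pi * t) * η t with hIdef
    have hs : (Real.sqrt 2 / 8) ^ 2 = 32⁻¹ := by
      rw [div_pow, Real.sq_sqrt (by norm_num : (0 : ℝ) ≤ 2)]; norm_num
    have hJ2 : 32⁻¹ ≤ J ^ 2 := hs ▸ pow_le_pow_left₀ (by positivity) hJ 2
    have h1 : 32⁻¹ * (31 / 8) ≤ J ^ 2 * I := mul_le_mul hJ2 hηI (by norm_num) (sq_nonneg _)
    have h2 : 3 * (32⁻¹ * (31 / 8)) ≤ Real.pi * (J ^ 2 * I) :=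
      mul_le_mul Real.pi_gt_three.le h1 (by norm_num) Real.pi_pos.le
    have e : 2 * (J * (2 * Real.pi * J) * I) = 4 * (Real.pi * (J ^ 2 * I)) := by ring
    rw [e]
    linarith

end Summit.AnomalousDissipation.AnomalousDissipation.Theorems.MirrorEnsembleMirrorStatisticsLoudTG

end
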